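/-
# [B4] THEOREM (1.10) on a box Ω — geometry of the walk route's data (R9 carrier bridge, file 4/5)

statement-level skeleton of published theorems with citation tags; proofs where landed; nothing here is a claim about
the Yang–Mills mass gap

[B4] = Balaban, *Regularity and decay of lattice Green's functions*, Commun. Math. Phys. 89 (1983) 571–597.

`B4Ineq110WalkRoute.ineq110_value` (owner seat r01) proves the value member of THEOREM (1.10) p.573 for an
abstract site set `X` with positions `pos : X → ℝ^d`, a large-cube size `M`, the partition of unity
`h_j = hCube M j ∘ pos` ((2.5) p.575) and per-cube operators.  This file instantiates the GEOMETRIC data on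
[B4]'s box `Ω = Box d ℓ k Mb ⊂ L^{-k}ℤ^{d+1}` (`n = (ℓ+1)^k` fine points per unit length):

* positions `posR x = x / n` (unit-lattice units) and `M := K`, the print's large-cube size (p.575 «cubes
  □_j of size 2M»; here `8 ≤ K` so that bonds and averaging blocks have diameter `≤ M/8`, and `4 ∣ K` so that the
  block of a plateau point lies in the plateau);
* the cube `□_j = Ω ∩ {K(j−1) ≤ x/n < K(j+1)}` realised as the SUB-BOX `inSub (cubeMs j) (cubeLo j)` of
  `B4SubBoxCarrier` (corner `cubeLo`, sides `cubeMs`, always inside `Ω`: `cube_ho`);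
* the finite label set `labels Mb ∋ j` of all cubes meeting `Ω`;

and proves the geometric hypotheses of the walk route: `hc` (`boxWt_local`), `hq` (`blkWt_local`), `hs`
(`mem_labels_of_hCube_ne_zero`), `hS` (`cubeS_of_near`: the closed 7/8-box of centre `Kj` is inside `□_j`), the
plateau and the support of `h_j` are inside `□_j`, and the PLATEAU PATH LEMMA `contourTrans_plateau`: if two bond
fields agree on bonds with both endpoints in the closed 3/4-box, their staircase transporters `U(A(Γ_{y,x}))` agree at
every plateau point `x` (the hypothesis `hTT′` of the walk route for the cube fields of (2.6) p.576).
-/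
import Literature.MathematicalPhysics.QuantumFieldTheory.Balaban1983to89.B4SubBoxCarrier

namespace Literature.MathematicalPhysics.QuantumFieldTheory.Balaban1983to89.B4BoxCubeGeometry

open Literature.MathematicalPhysics.QuantumFieldTheory.Balaban1983to89.B4Reflection242 (boxDom mem_boxDom nbrs mem_nbrs
  mem_nbrs_iff_sub blk)
open Literature.MathematicalPhysics.QuantumFieldTheory.Balaban1983to89.B4GaugeCovariance
open Literature.MathematicalPhysics.QuantumFieldTheory.Balaban1983to89.B4Lower18Regular (lsum stair mem_stair baseEmb
  stairContour base_le_of_blk blkWt_ne_zero transport_fieldLink)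
open Literature.MathematicalPhysics.QuantumFieldTheory.Balaban1983to89.B4Lemma22ReduceZero (Box)
open Literature.MathematicalPhysics.QuantumFieldTheory.Balaban1983to89.B4PartitionUnity22 (hCube hCube_ne_zero_imp)
open Literature.MathematicalPhysics.QuantumFieldTheory.Balaban1983to89.B4SubBoxCarrier

noncomputable section

variable {d : ℕ}

/-! ## 1. A congruence lemma for bond sums along paths -/

/-- two bond fields agreeing on pairs of a set `P` have the same sum along any path inside `P`. [folklore] -/
private theorem lsum_congr {X : Type*} {B B' : X → X → ℝ} {P : X → Prop} (h : ∀ u v, P u → P v → B u v = B' u v) :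
    ∀ (x : X) (l : List X), P x → (∀ z ∈ l, P z) → lsum B x l = lsum B' x l
  | _, [], _, _ => rfl
  | x, y :: l, hx, hl => by
      have hy : P y := hl y (by simp)
      rw [lsum, lsum, h x y hx hy, lsum_congr h y l hy fun z hz => hl z (by simp [hz])]

/-! ## 2. Positions, cubes and labels on the box `Ω = Box d ℓ k Mb` -/

section Geometry

variable (ℓ k : ℕ) (Mb : Fin (d + 1) → ℕ) (K : ℕ)

/-- **POSITIONS IN UNIT-LATTICE UNITS**: `pos x = x/n`, `n = L^k` (the fine lattice is `L^{-k}ℤ^{d+1}`; [B4]'s unit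
lattice `ℤ^{d+1}` carries the large cubes of size `M`). [cite: Balaban1983RegularityDecay, §1 p.572, §2 p.575, dictionary] -/
def posR (x : ↥(Box d ℓ k Mb)) : Fin (d + 1) → ℝ := fun μ => (x.1 μ : ℝ) / (((ℓ + 1) ^ k : ℕ) : ℝ)

/-- **THE CUBE CORNER** (unit-lattice units): `max(0, K(j−1))` clipped to the box.
[cite: Balaban1983RegularityDecay, §2 p.575 «□_j … of size 2M», dictionary] -/
def cubeLo (j : Fin (d + 1) → ℤ) : Fin (d + 1) → ℕ := fun μ => min (Mb μ) ((K : ℤ) * (j μ - 1)).toNat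

/-- **THE CUBE'S FAR CORNER**: `min(Mb, K(j+1))`. [cite: Balaban1983RegularityDecay, §2 p.575, dictionary] -/
def cubeHi (j : Fin (d + 1) → ℤ) : Fin (d + 1) → ℕ := fun μ => min (Mb μ) ((K : ℤ) * (j μ + 1)).toNat

/-- **THE CUBE'S SIDES** `cubeHi − cubeLo` (so `□_j = Ω ∩ (2K-cube of centre Kj)`).
[cite: Balaban1983RegularityDecay, §2 p.575, dictionary] -/
def cubeMs (j : Fin (d + 1) → ℤ) : Fin (d + 1) → ℕ := fun μ => cubeHi Mb K j μ - cubeLo Mb K j μ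

/-- the cube is a sub-box of `Ω`: `cubeLo + cubeMs ≤ Mb`. [cite: Balaban1983RegularityDecay, §2 p.575, dictionary] -/
theorem cube_ho (j : Fin (d + 1) → ℤ) : ∀ μ, cubeLo Mb K j μ + cubeMs Mb K j μ ≤ Mb μ := by
  intro μ
  unfold cubeMs
  rcases le_total (cubeLo Mb K j μ) (cubeHi Mb K j μ) with h | h
  · rw [Nat.add_sub_cancel' h]; exact min_le_left _ _
  · rw [Nat.sub_eq_zero_of_le h, add_zero]; exact min_le_left _ _

/-- **THE CUBE `□_j` AS A PREDICATE ON `Ω`** (the walk route's `S j`): the sites of the sub-box of corner `cubeLo j`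
and sides `cubeMs j`. [cite: Balaban1983RegularityDecay, §2 p.575, dictionary] -/
abbrev cubeS (j : Fin (d + 1) → ℤ) : ↥(Box d ℓ k Mb) → Prop := inSub ℓ k Mb (cubeMs Mb K j) (cubeLo Mb K j)

/-- **THE LABELS**: cubes meeting `Ω` have `0 ≤ j ≤ Mb` coordinatewise. [cite: Balaban1983RegularityDecay, §2 p.575,
dictionary] -/
def labels : Finset (Fin (d + 1) → ℤ) := Fintype.piFinset fun μ => Finset.Icc (0 : ℤ) (Mb μ)

variable {ℓ k Mb K}

/-- `0 < n`. [folklore] -/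
private theorem nR_pos : (0 : ℝ) < (((ℓ + 1) ^ k : ℕ) : ℝ) := by exact_mod_cast pow_pos (Nat.succ_pos ℓ) k

/-- the box inequalities `0 ≤ z < n·Mb` in `ℝ`. [folklore] -/
private theorem box_bounds (z : ↥(Box d ℓ k Mb)) (μ : Fin (d + 1)) :
    (0 : ℝ) ≤ z.1 μ ∧ (z.1 μ : ℝ) < (((ℓ + 1) ^ k : ℕ) : ℝ) * Mb μ := by
  have h := (mem_boxDom.1 z.2) μ
  refine ⟨by exact_mod_cast h.1, ?_⟩
  have h2 : z.1 μ < (((ℓ + 1) ^ k * Mb μ : ℕ) : ℤ) := h.2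
  push_cast at h2
  exact_mod_cast h2

/-- **`hS` OF THE WALK ROUTE**: the closed 7/8-box of centre `Kj` (unit-lattice units) inside `Ω` lies in the cube
`□_j`. [cite: Balaban1983RegularityDecay, (2.6) p.576 «□_j», §2 p.575] -/
theorem cubeS_of_near (hK : 1 ≤ K) (j : Fin (d + 1) → ℤ) (z : ↥(Box d ℓ k Mb))
    (h : ∀ μ, |posR ℓ k Mb z μ - (K : ℝ) * j μ| ≤ 7 / 8 * (K : ℝ)) : cubeS ℓ k Mb K j z := by
  intro μ
  have hn := nR_pos (ℓ := ℓ) (k := k)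
  have hKr : (0 : ℝ) < K := by exact_mod_cast hK
  obtain ⟨hz0, hzM⟩ := box_bounds z μ
  obtain ⟨h1, h2⟩ := abs_le.1 (h μ)
  rw [posR] at h1 h2
  -- the two real consequences `nK(j−1) ≤ z < nK(j+1)`
  have lo1 : ((((ℓ + 1) ^ k : ℕ) : ℤ) * ((K : ℤ) * (j μ - 1)) : ℤ) ≤ z.1 μ := by
    have : (((ℓ + 1) ^ k : ℕ) : ℝ) * ((K : ℝ) * (j μ - 1)) ≤ z.1 μ := by
      have h1' : ((K : ℝ) * j μ - 7 / 8 * K) * (((ℓ + 1) ^ k : ℕ) : ℝ) ≤ z.1 μ := by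
        rw [← le_div_iff₀ hn]; linarith
      nlinarith [mul_nonneg hKr.le hn.le]
    exact_mod_cast this
  have hi1 : z.1 μ < ((((ℓ + 1) ^ k : ℕ) : ℤ) * ((K : ℤ) * (j μ + 1)) : ℤ) := by
    have : (z.1 μ : ℝ) < (((ℓ + 1) ^ k : ℕ) : ℝ) * ((K : ℝ) * (j μ + 1)) := by
      have h2' : (z.1 μ : ℝ) ≤ ((K : ℝ) * j μ + 7 / 8 * K) * (((ℓ + 1) ^ k : ℕ) : ℝ) := by
        rw [← div_le_iff₀ hn]; linarith
      nlinarith [mul_pos hKr hn]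
    exact_mod_cast this
  have hz0' : (0 : ℤ) ≤ z.1 μ := (mem_boxDom.1 z.2 μ).1
  have hzM' : z.1 μ < (((ℓ + 1) ^ k : ℕ) : ℤ) * (Mb μ : ℤ) := by
    have := (mem_boxDom.1 z.2 μ).2; push_cast at this; exact this
  have hn' : (0 : ℤ) ≤ (((ℓ + 1) ^ k : ℕ) : ℤ) := by positivity
  constructor
  · -- `n·cubeLo ≤ z`
    calc (((ℓ + 1) ^ k : ℕ) : ℤ) * (cubeLo Mb K j μ : ℤ)
        ≤ (((ℓ + 1) ^ k : ℕ) : ℤ) * ((((K : ℤ) * (j μ - 1)).toNat : ℕ) : ℤ) := by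
          apply mul_le_mul_of_nonneg_left _ hn'
          exact_mod_cast (min_le_right _ _ : cubeLo Mb K j μ ≤ _)
      _ = max ((((ℓ + 1) ^ k : ℕ) : ℤ) * ((K : ℤ) * (j μ - 1))) 0 := by
          rw [Int.toNat_eq_max, mul_max_of_nonneg _ _ hn', mul_zero]
      _ ≤ z.1 μ := max_le lo1 hz0'
  · -- `z < n·(cubeLo + cubeMs)`, and `cubeLo + cubeMs ≥ cubeHi`
    have hhi : cubeHi Mb K j μ ≤ cubeLo Mb K j μ + cubeMs Mb K j μ := le_add_tsub
    calc z.1 μ < (((ℓ + 1) ^ k : ℕ) : ℤ) * (cubeHi Mb K j μ : ℤ) := by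
          unfold cubeHi
          rcases min_choice (Mb μ) (((K : ℤ) * (j μ + 1)).toNat) with hm | hm <;> rw [hm]
          · exact hzM'
          · rw [Int.toNat_eq_max, mul_max_of_nonneg _ _ hn', mul_zero]
            exact lt_max_of_lt_left hi1
      _ ≤ (((ℓ + 1) ^ k : ℕ) : ℤ) * ((cubeLo Mb K j μ : ℤ) + cubeMs Mb K j μ) := by
          apply mul_le_mul_of_nonneg_left _ hn'
          exact_mod_cast hhi

/-- the closed 3/4-box (the plateau `{θ_j = 1}` of (2.6)) lies in the cube. [cite: Balaban1983RegularityDecay, (2.6) p.576] -/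
theorem cubeS_of_plateau (hK : 1 ≤ K) (j : Fin (d + 1) → ℤ) (z : ↥(Box d ℓ k Mb))
    (h : ∀ μ, |posR ℓ k Mb z μ - (K : ℝ) * j μ| ≤ 3 / 4 * (K : ℝ)) : cubeS ℓ k Mb K j z :=
  cubeS_of_near hK j z fun μ => (h μ).trans (by
    have : (0 : ℝ) ≤ K := Nat.cast_nonneg K
    nlinarith)

/-- the support of `h_j` (inside the open 5/8-box, `B4PartitionUnity22.hCube_ne_zero_imp`) lies in the cube.
[cite: Balaban1983RegularityDecay, (2.5)–(2.6) pp.575–576] -/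
theorem cubeS_of_hCube_ne_zero (hK : 1 ≤ K) (j : Fin (d + 1) → ℤ) (z : ↥(Box d ℓ k Mb))
    (h : hCube (K : ℝ) j (posR ℓ k Mb z) ≠ 0) : cubeS ℓ k Mb K j z := by
  have hKr : (0 : ℝ) < K := by exact_mod_cast hK
  exact cubeS_of_near hK j z fun μ => (hCube_ne_zero_imp hKr h μ).le.trans (by nlinarith)

/-- **`hs` OF THE WALK ROUTE**: a cube whose `h_j` does not vanish on `Ω` has its label in `labels Mb`.
[cite: Balaban1983RegularityDecay, (2.5) p.575] -/
theorem mem_labels_of_hCube_ne_zero (hK : 1 ≤ K) (j : Fin (d + 1) → ℤ) (x : ↥(Box d ℓ k Mb))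
    (h : hCube (K : ℝ) j (posR ℓ k Mb x) ≠ 0) : j ∈ labels Mb := by
  have hKr : (0 : ℝ) < K := by exact_mod_cast hK
  have hK1 : (1 : ℝ) ≤ K := by exact_mod_cast hK
  have hn := nR_pos (ℓ := ℓ) (k := k)
  rw [labels, Fintype.mem_piFinset]
  intro μ
  rw [Finset.mem_Icc]
  have hμ := abs_lt.1 (hCube_ne_zero_imp hKr h μ)
  rw [posR] at hμ
  obtain ⟨hz0, hzM⟩ := box_bounds x μ
  have hp0 : (0 : ℝ) ≤ (x.1 μ : ℝ) / (((ℓ + 1) ^ k : ℕ) : ℝ) := div_nonneg hz0 hn.le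
  have hpM : (x.1 μ : ℝ) / (((ℓ + 1) ^ k : ℕ) : ℝ) < Mb μ := by rw [div_lt_iff₀ hn, mul_comm]; exact hzM
  have hM0 : (0 : ℝ) ≤ Mb μ := Nat.cast_nonneg _
  constructor
  · have : (-1 : ℝ) < j μ := by nlinarith
    have : (-1 : ℤ) < j μ := by exact_mod_cast this
    omega
  · have : (j μ : ℝ) < Mb μ + 1 := by nlinarith
    have : j μ < (Mb μ : ℤ) + 1 := by exact_mod_cast this
    omega

/-! ## 3. Locality of bonds and blocks (`hc`, `hq`) -/

/-- **`hc` OF THE WALK ROUTE**: a bond of `Ω` joins sites at sup-distance `1/n ≤ 1 ≤ K/8` (unit-lattice units).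
[cite: Balaban1983RegularityDecay, (1.3) p.572, (2.13) p.577] -/
theorem boxWt_local (hK : 8 ≤ K) {x z' : ↥(Box d ℓ k Mb)}
    (h : boxWt ((ℓ + 1) ^ k) (fun i => (ℓ + 1) ^ k * Mb i) x z' ≠ 0) (μ : Fin (d + 1)) :
    |posR ℓ k Mb x μ - posR ℓ k Mb z' μ| ≤ 1 / 8 * (K : ℝ) := by
  have hn := nR_pos (ℓ := ℓ) (k := k)
  have hn1 : (1 : ℝ) ≤ (((ℓ + 1) ^ k : ℕ) : ℝ) := by exact_mod_cast pow_pos (Nat.succ_pos ℓ) k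
  have hK8 : (8 : ℝ) ≤ K := by exact_mod_cast hK
  have hmem : z'.1 ∈ nbrs x.1 := by
    by_contra hc
    apply h
    unfold boxWt
    rw [if_neg hc, mul_zero]
  have h1 : |(x.1 μ : ℝ) - z'.1 μ| ≤ 1 := by
    obtain ⟨i, hi⟩ := mem_nbrs_iff_sub.1 hmem
    have hd : (x.1 μ : ℝ) - z'.1 μ = -(((z'.1 - x.1) μ : ℤ) : ℝ) := by push_cast [Pi.sub_apply]; ring
    rw [hd, abs_neg]
    rcases hi with hi | hi <;> rw [hi] <;> by_cases hμ : μ = i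
    · subst hμ; simp
    · simp [hμ]
    · subst hμ; simp
    · simp [hμ]
  rw [posR, posR, ← sub_div, abs_div, abs_of_pos hn]
  calc |(x.1 μ : ℝ) - z'.1 μ| / (((ℓ + 1) ^ k : ℕ) : ℝ) ≤ |(x.1 μ : ℝ) - z'.1 μ| :=
        div_le_self (abs_nonneg _) hn1
    _ ≤ 1 / 8 * (K : ℝ) := h1.trans (by linarith)

/-- **`hq` OF THE WALK ROUTE**: two fine sites of the same averaging block `B(y)` are at sup-distance `< 1 ≤ K/8`.
[cite: Balaban1983RegularityDecay, (1.4) p.572, (2.13) p.577] -/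
theorem blkWt_local (hK : 8 ≤ K) {y : ↥(boxDom Mb)} {x z' : ↥(Box d ℓ k Mb)}
    (hx : blkWt ((ℓ + 1) ^ k) Mb (fun i => (ℓ + 1) ^ k * Mb i) y x ≠ 0)
    (hz : blkWt ((ℓ + 1) ^ k) Mb (fun i => (ℓ + 1) ^ k * Mb i) y z' ≠ 0) (μ : Fin (d + 1)) :
    |posR ℓ k Mb x μ - posR ℓ k Mb z' μ| ≤ 1 / 8 * (K : ℝ) := by
  have hn := nR_pos (ℓ := ℓ) (k := k)
  have hn1 : 1 ≤ (ℓ + 1) ^ k := pow_pos (Nat.succ_pos ℓ) k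
  have hK8 : (8 : ℝ) ≤ K := by exact_mod_cast hK
  obtain ⟨hx1, hx2⟩ := base_le_of_blk hn1 (blkWt_ne_zero hx)
  obtain ⟨hz1, hz2⟩ := base_le_of_blk hn1 (blkWt_ne_zero hz)
  have a1' : (((ℓ + 1) ^ k : ℕ) : ℤ) * y.1 μ ≤ x.1 μ := hx1 μ
  have b1' : (((ℓ + 1) ^ k : ℕ) : ℤ) * y.1 μ ≤ z'.1 μ := hz1 μ
  have a1 : (((ℓ + 1) ^ k : ℕ) : ℝ) * (y.1 μ : ℝ) ≤ (x.1 μ : ℝ) := by exact_mod_cast a1'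
  have a2 : (x.1 μ : ℝ) - (((ℓ + 1) ^ k : ℕ) : ℝ) * (y.1 μ : ℝ) ≤ (((ℓ + 1) ^ k : ℕ) : ℝ) := by
    exact_mod_cast hx2 μ
  have b1 : (((ℓ + 1) ^ k : ℕ) : ℝ) * (y.1 μ : ℝ) ≤ (z'.1 μ : ℝ) := by exact_mod_cast b1'
  have b2 : (z'.1 μ : ℝ) - (((ℓ + 1) ^ k : ℕ) : ℝ) * (y.1 μ : ℝ) ≤ (((ℓ + 1) ^ k : ℕ) : ℝ) := by
    exact_mod_cast hz2 μ
  have h1 : |(x.1 μ : ℝ) - z'.1 μ| ≤ (((ℓ + 1) ^ k : ℕ) : ℝ) := abs_le.2 ⟨by linarith, by linarith⟩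
  rw [posR, posR, ← sub_div, abs_div, abs_of_pos hn, div_le_iff₀ hn]
  calc |(x.1 μ : ℝ) - z'.1 μ| ≤ (((ℓ + 1) ^ k : ℕ) : ℝ) := h1
    _ = 1 * (((ℓ + 1) ^ k : ℕ) : ℝ) := (one_mul _).symm
    _ ≤ 1 / 8 * (K : ℝ) * (((ℓ + 1) ^ k : ℕ) : ℝ) := mul_le_mul_of_nonneg_right (by linarith) hn.le

/-! ## 4. The plateau path lemma (`hTT′`) -/

/-- a fine site between the base corner `n·⌊x/n⌋` of the block of a plateau point `x` and `x` itself is in the plateau,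
when `4 ∣ K` (the plateau's lower faces `K j − 3K/4` are then block boundaries). [cite: Balaban1983RegularityDecay,
(2.6) p.576, (1.4) p.572 «Γ_{y,x} ⊂ B(y)»] -/
theorem plateau_of_between (h4 : 4 ∣ K) {j : Fin (d + 1) → ℤ} {x z : ↥(Box d ℓ k Mb)}
    (hx : ∀ μ, |posR ℓ k Mb x μ - (K : ℝ) * j μ| ≤ 3 / 4 * (K : ℝ))
    (h1 : ∀ μ, (((ℓ + 1) ^ k : ℕ) : ℤ) * (x.1 μ / (((ℓ + 1) ^ k : ℕ) : ℤ)) ≤ z.1 μ) (h2 : ∀ μ, z.1 μ ≤ x.1 μ)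
    (μ : Fin (d + 1)) : |posR ℓ k Mb z μ - (K : ℝ) * j μ| ≤ 3 / 4 * (K : ℝ) := by
  obtain ⟨K', rfl⟩ := h4
  have hn := nR_pos (ℓ := ℓ) (k := k)
  have hnz : (0 : ℤ) < (((ℓ + 1) ^ k : ℕ) : ℤ) := by exact_mod_cast pow_pos (Nat.succ_pos ℓ) k
  have hK4 : ((4 * K' : ℕ) : ℝ) = 4 * (K' : ℝ) := by push_cast; ring
  obtain ⟨hl, hu⟩ := abs_le.1 (hx μ)
  rw [posR, hK4] at hl hu
  rw [posR, hK4]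
  refine abs_le.2 ⟨?_, ?_⟩
  · -- the integer `m = 4K′j − 3K′ = Kj − 3K/4` satisfies `m·n ≤ x`, hence `m ≤ ⌊x/n⌋`, hence `m·n ≤ n⌊x/n⌋ ≤ z`
    have hmr : (4 * (K' : ℝ) * j μ - 3 * K') * (((ℓ + 1) ^ k : ℕ) : ℝ) ≤ x.1 μ := by
      rw [← le_div_iff₀ hn]
      linarith
    have hm' : (4 * (K' : ℤ) * j μ - 3 * K') * (((ℓ + 1) ^ k : ℕ) : ℤ) ≤ x.1 μ := by exact_mod_cast hmr
    have hdiv : 4 * (K' : ℤ) * j μ - 3 * K' ≤ x.1 μ / (((ℓ + 1) ^ k : ℕ) : ℤ) := Int.le_ediv_of_mul_le hnz hm'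
    have hz : (((ℓ + 1) ^ k : ℕ) : ℤ) * (4 * (K' : ℤ) * j μ - 3 * K') ≤ z.1 μ :=
      (mul_le_mul_of_nonneg_left hdiv hnz.le).trans (h1 μ)
    have hzr : (((ℓ + 1) ^ k : ℕ) : ℝ) * (4 * (K' : ℝ) * j μ - 3 * K') ≤ z.1 μ := by exact_mod_cast hz
    rw [le_sub_iff_add_le, le_div_iff₀ hn]
    linarith
  · have hzx : (z.1 μ : ℝ) ≤ x.1 μ := by exact_mod_cast h2 μ
    have := div_le_div_of_nonneg_right hzx hn.le
    linarith

/-- **THE PLATEAU PATH LEMMA** (`hTT′` of the walk route): bond fields agreeing on bonds with both endpoints in the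
closed 3/4-box `{|x/n − Kj|_∞ ≤ 3K/4}` have the same staircase transporters `U(A(Γ_{y,x}))` at every plateau point
`x ∈ B(y)` — the staircase from the base corner of `B(y)` to `x` stays in the plateau (`4 ∣ K`).
[cite: Balaban1983RegularityDecay, (2.6) p.576 «A_j = A on {θ_j = 1}», (1.4) p.572] -/
theorem contourTrans_plateau {ι : Type} [Fintype ι] [DecidableEq ι] (F : OrthFlow ι) (κ : ℝ) (h4 : 4 ∣ K)
    (hn : 1 ≤ (ℓ + 1) ^ k) {A A' : ↥(Box d ℓ k Mb) → ↥(Box d ℓ k Mb) → ℝ} {j : Fin (d + 1) → ℤ}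
    (hplat : ∀ u v : ↥(Box d ℓ k Mb), (∀ μ, |posR ℓ k Mb u μ - (K : ℝ) * j μ| ≤ 3 / 4 * (K : ℝ)) →
      (∀ μ, |posR ℓ k Mb v μ - (K : ℝ) * j μ| ≤ 3 / 4 * (K : ℝ)) → A' u v = A u v)
    {x : ↥(Box d ℓ k Mb)} (hx : ∀ μ, |posR ℓ k Mb x μ - (K : ℝ) * j μ| ≤ 3 / 4 * (K : ℝ))
    {y : ↥(boxDom Mb)} (hy : blkWt ((ℓ + 1) ^ k) Mb (fun i => (ℓ + 1) ^ k * Mb i) y x ≠ 0) :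
    contourTrans (fieldLink F κ A') (baseEmb hn Mb) (stairContour hn Mb) y x
      = contourTrans (fieldLink F κ A) (baseEmb hn Mb) (stairContour hn Mb) y x := by
  have hb := blkWt_ne_zero hy
  have hbase := base_le_of_blk hn hb
  have hyμ : ∀ μ, y.1 μ = x.1 μ / (((ℓ + 1) ^ k : ℕ) : ℤ) := fun μ => by rw [← hb]; rfl
  have hP : ∀ z : ↥(Box d ℓ k Mb), (fun i => (((ℓ + 1) ^ k : ℕ) : ℤ) * y.1 i) ≤ z.1 → z.1 ≤ x.1 →
      ∀ μ, |posR ℓ k Mb z μ - (K : ℝ) * j μ| ≤ 3 / 4 * (K : ℝ) := fun z hz1 hz2 =>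
    plateau_of_between h4 hx (fun μ => by rw [← hyμ μ]; exact hz1 μ) (fun μ => hz2 μ)
  unfold contourTrans
  rw [transport_fieldLink, transport_fieldLink,
    lsum_congr (P := fun z : ↥(Box d ℓ k Mb) => ∀ μ, |posR ℓ k Mb z μ - (K : ℝ) * j μ| ≤ 3 / 4 * (K : ℝ))
      (fun u v hu hv => hplat u v hu hv) _ _ (hP _ (fun μ => le_rfl) hbase.1) ?_]
  intro z hz
  have hz' : z.1 ∈ (stairContour hn Mb y x).map Subtype.val := List.mem_map.2 ⟨z, hz, rfl⟩
  rw [map_val_stairContour, if_pos hb] at hz'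
  obtain ⟨hz1, hz2⟩ := mem_stair hbase.1 hz'
  exact hP z hz1 hz2

end Geometry

end

end Literature.MathematicalPhysics.QuantumFieldTheory.Balaban1983to89.B4BoxCubeGeometry
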